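import Summits.PneNP.PneNP.Theses.PlantedClique
import Literature.Probability.RandomGraphs.PlantedCliqueUnique
import Literature.Probability.RandomGraphs.PlantedCliqueProgramMatrix

/-!
# Crux `PlantedClique.PlantedcliqueIndistinguishable` (stmt-PneNP-8684) — negative side, II:
the time bound on the tests is load-bearing inside the admissible window

Refuter's crux-attack by-product (route PneNP/PlantedClique, decl
`Summit.PneNP.PneNP.Theses.PlantedClique.PlantedcliqueIndistinguishable`).

* `toOuterMeasure_exists_clique_le` — FIRST-MOMENT BOUND for the clique number of `G(n,1/2)`:
  `Pr[G(n,1/2) has a k-clique] ≤ C(n,k) · 2^{-⌊k(k−1)/2⌋}` (Matula / Grimmett–McDiarmid;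
  engine `toOuterMeasure_forall_eq_true_le` of `PlantedCliqueUnique.lean` + union bound). This is
  the type-I half of every clique test of the route (cf. item `ErdosRenyiNoLargeClique`).
* `cliqueTest κ` — the (computationally unbounded, coin-free) test "the input graph has a clique of
  size `κ n`", reading `n` and the adjacency bits off `boolPair 1ⁿ (encodeEdgeVec G)` through the
  tree's `boolUnpair`, `unaryDecodeNat` and `AKSProg.adj` (`adj_encodeEdgeVec`); its type-II error
  is `0` once `κ n ≤ n`, its type-I error is at most the first-moment bound.
* `four_mul_choose_kappa_le`, `kappa_admissible` — at `κ n = 4 ⌊log₂ n⌋ + 4` the bound is `≤ 1/4`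
  for EVERY `n`, and `κ` is admissible (`κ n ≤ n^{1/4} = n^{1/2 − 1/4}` eventually, via
  `isLittleO_log_rpow_atTop`).
* `plantedcliqueIndistinguishable_false_without_polyTime` — LOAD-BEARING ANALYSIS: the crux with
  the hypothesis `T.IsPolyTime id (fun b => [b])` deleted (tests = every `RandAlg (List Bool) Bool`) is
  FALSE, witnessed INSIDE the admissible window by `κ` and `cliqueTest κ` (error sum `≤ 1/4`
  eventually). Together with `FalseWithoutAdmissible.lean` (the size restriction is load-bearing)
  this pins the content of the crux to "polynomial time × `2 log₂ n ≲ k ≤ n^{1/2−ε}`", i.e. to the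
  Planted Clique conjecture proper (Jerrum 1992 §5; BBH18 Conj. 2.1).
-/

namespace Summit.PneNP.PneNP.Theorems.PlantedcliqueIndistinguishable.Negative

open Literature.Probability.RandomGraphs.PlantedClique Literature.Computability.Complexity
  Filter Topology Finset Asymptotics
open _root_.Computability (unaryEncodeNat unaryDecodeNat unary_decode_encode_nat)
open scoped ENNReal

noncomputable section

variable {n : ℕ}

/-! ## First-moment bound for cliques of `G(n, 1/2)` -/

/-- The edges of `Kₙ` with both endpoints in `T` (the `crossEdges(∅, T)` of
`PlantedCliqueUnique.lean`, written out). [folklore] -/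
def insideEdges (T : Finset (Fin n)) : Finset (⊤ : SimpleGraph (Fin n)).edgeSet :=
  Finset.filter (fun e : (⊤ : SimpleGraph (Fin n)).edgeSet =>
    Subtype.val e ∈ Finset.sym2 T ∧ Subtype.val e ∉ Finset.sym2 (∅ : Finset (Fin n))) Finset.univ

/-- Planting on the empty set changes nothing. [folklore] -/
theorem plant_empty (x : EdgeVec n) : plant ∅ x = x := by
  funext e
  obtain ⟨e, he⟩ := e
  induction e using Sym2.ind with
  | h a b =>
    have hnot : ¬ ∀ v ∈ (s(a, b) : Sym2 (Fin n)), v ∈ (∅ : Finset (Fin n)) :=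
      fun h => by simpa using h a (Sym2.mem_mk_left a b)
    simp only [plant, hnot, decide_false, Bool.or_false]

/-- A clique on `T` forces every edge inside `T`. [folklore] -/
theorem forall_insideEdges_of_isClique {T : Finset (Fin n)} {x : EdgeVec n}
    (h : (graphOfEdgeVec x).IsClique (T : Set (Fin n))) : ∀ e ∈ insideEdges T, x e = true := by
  have h' : (graphOfEdgeVec (plant ∅ x)).IsClique (T : Set (Fin n)) := by rwa [plant_empty]
  exact eq_true_of_isClique_plant h'

/-- There are at least `C(|T|, 2)` edges inside `T` (double counting,
`card_sdiff_mul_le_two_mul_card_crossEdges`). [folklore] -/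
theorem card_mul_le_two_mul_card_insideEdges (T : Finset (Fin n)) :
    T.card * (T.card - 1) ≤ 2 * (insideEdges T).card := by
  have h := card_sdiff_mul_le_two_mul_card_crossEdges (∅ : Finset (Fin n)) T
  rw [sdiff_empty] at h
  exact h

/-- **First-moment bound** (Matula 1970; Grimmett–McDiarmid 1975): under `G(n,1/2)` a clique of
size `k` exists with probability at most `C(n,k) · 2^{-⌊k(k-1)/2⌋}`. [folklore] -/
theorem toOuterMeasure_exists_clique_le (n k : ℕ) :
    (erdosRenyiHalf n).toOuterMeasure
        {x | ∃ T : Finset (Fin n), T.card = k ∧ (graphOfEdgeVec x).IsClique (T : Set (Fin n))} ≤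
      (n.choose k : ℝ≥0∞) * 2⁻¹ ^ (k * (k - 1) / 2) := by
  classical
  set r : ℝ≥0∞ := 2⁻¹ ^ (k * (k - 1) / 2) with hr
  set 𝒯 := powersetCard k (univ : Finset (Fin n)) with h𝒯
  have hsub : {x : EdgeVec n | ∃ T : Finset (Fin n), T.card = k ∧
      (graphOfEdgeVec x).IsClique (T : Set (Fin n))} ⊆
      ⋃ T ∈ 𝒯, {x | ∀ e ∈ insideEdges T, x e = true} := by
    rintro x ⟨T, hTk, hTc⟩
    have hT : T ∈ 𝒯 := by
      rw [h𝒯, mem_powersetCard]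
      exact ⟨subset_univ _, hTk⟩
    exact Set.mem_biUnion hT (forall_insideEdges_of_isClique hTc)
  have hT : ∀ T ∈ 𝒯,
      (erdosRenyiHalf n).toOuterMeasure {x | ∀ e ∈ insideEdges T, x e = true} ≤ r := by
    intro T hT
    rw [h𝒯, mem_powersetCard] at hT
    refine (toOuterMeasure_forall_eq_true_le _).trans ?_
    refine pow_le_pow_of_le_one zero_le (ENNReal.inv_le_one.2 one_le_two) ?_
    have h2 := card_mul_le_two_mul_card_insideEdges T
    rw [hT.2] at h2
    generalize k * (k - 1) = m at h2 ⊢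
    omega
  calc (erdosRenyiHalf n).toOuterMeasure
        {x | ∃ T : Finset (Fin n), T.card = k ∧ (graphOfEdgeVec x).IsClique (T : Set (Fin n))}
      ≤ (erdosRenyiHalf n).toOuterMeasure (⋃ T ∈ 𝒯, {x | ∀ e ∈ insideEdges T, x e = true}) :=
        (erdosRenyiHalf n).toOuterMeasure.mono hsub
    _ ≤ ∑ T ∈ 𝒯, (erdosRenyiHalf n).toOuterMeasure {x | ∀ e ∈ insideEdges T, x e = true} :=
        MeasureTheory.measure_biUnion_finset_le _ _
    _ ≤ ∑ T ∈ 𝒯, r := sum_le_sum hT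
    _ = (n.choose k : ℝ≥0∞) * r := by
        rw [sum_const, nsmul_eq_mul, h𝒯, card_powersetCard, card_univ, Fintype.card_fin]

/-! ## The clique-number test (no time bound) -/

open Classical in
/-- The coin-free test "the input graph has a clique of size `κ n`": decode `n` (unary, first
component of the pair) and query adjacency bits through `AKSProg.adj`. No time bound is claimed
(the search is over all `κ n`-subsets). [folklore] -/
def cliqueTest (κ : ℕ → ℕ) (z : List Bool) : Bool :=
  decide (∃ T : Finset (Fin (unaryDecodeNat (boolUnpair z).1)),
    T.card = κ (unaryDecodeNat (boolUnpair z).1) ∧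
      ∀ i ∈ T, ∀ j ∈ T, i ≠ j →
        AKSProg.adj (unaryDecodeNat (boolUnpair z).1) (boolUnpair z).2 i j = true)

/-- On a planted-clique input the test accepts iff the graph has a clique of size `κ n`
(`AKSProg.adj_encodeEdgeVec`). [folklore] -/
theorem cliqueTest_boolPair (κ : ℕ → ℕ) (n : ℕ) (G : EdgeVec n) :
    cliqueTest κ (boolPair (unaryEncodeNat n) (encodeEdgeVec G)) = true ↔
      ∃ T : Finset (Fin n), T.card = κ n ∧ (graphOfEdgeVec G).IsClique (T : Set (Fin n)) := by
  unfold cliqueTest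
  rw [boolUnpair_boolPair]
  dsimp only
  have key : ∀ m : ℕ, m = n →
      ((decide (∃ T : Finset (Fin m), T.card = κ m ∧ ∀ i ∈ T, ∀ j ∈ T, i ≠ j →
          AKSProg.adj m (encodeEdgeVec G) i j = true)) = true ↔
        ∃ T : Finset (Fin n), T.card = κ n ∧ (graphOfEdgeVec G).IsClique (T : Set (Fin n))) := by
    rintro m rfl
    rw [decide_eq_true_eq]
    refine exists_congr fun T => and_congr Iff.rfl ?_
    rw [SimpleGraph.isClique_iff, Set.Pairwise]
    refine forall₂_congr fun i _ => forall₂_congr fun j _ => imp_congr_right fun _ => ?_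
    exact AKSProg.adj_encodeEdgeVec G i j
  exact key _ (unary_decode_encode_nat n)

/-- Acceptance probability of a coin-free test = mass of its acceptance event. [folklore] -/
theorem acceptProbOn_ofDet_eq {n : ℕ} (g : List Bool → Bool) (D : PMF (EdgeVec n)) :
    acceptProbOn (RandAlg.ofDet g) D =
      (D.toOuterMeasure {G | g (boolPair (unaryEncodeNat n) (encodeEdgeVec G)) = true}).toReal := by
  rw [acceptProbOn]
  congr 1
  rw [PMF.toOuterMeasure_bind_apply, PMF.toOuterMeasure_apply]
  refine tsum_congr fun G => ?_
  rw [RandAlg.outputPMF_ofDet, PMF.toOuterMeasure_pure_apply]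
  by_cases h : g (boolPair (unaryEncodeNat n) (encodeEdgeVec G)) = true
  · rw [Set.indicator_of_mem (show G ∈ {G : EdgeVec n |
        g (boolPair (unaryEncodeNat n) (encodeEdgeVec G)) = true} from h),
      if_pos (by simpa using h), mul_one]
  · rw [Set.indicator_of_notMem (show G ∉ {G : EdgeVec n |
        g (boolPair (unaryEncodeNat n) (encodeEdgeVec G)) = true} from h),
      if_neg (by simpa using h), mul_zero]

/-- Type-II error of the clique-number test vanishes as soon as `κ n ≤ n` (the planted set is a
`κ n`-clique surely). [folklore] -/
theorem typeIIError_cliqueTest_eq_zero {κ : ℕ → ℕ} {n : ℕ} (hκ : κ n ≤ n) :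
    typeIIError (RandAlg.ofDet (cliqueTest κ)) κ n = 0 := by
  rw [typeIIError, acceptProbOn_ofDet_eq, sub_eq_zero, eq_comm, ENNReal.toReal_eq_one_iff,
    PMF.toOuterMeasure_apply_eq_one_iff]
  intro G hG
  rw [Set.mem_setOf_eq, cliqueTest_boolPair]
  rw [plantedCliqueDist, PMF.support_map] at hG
  obtain ⟨p, hp, rfl⟩ := hG
  obtain ⟨hcard, hclique⟩ := mem_support_plantedCliqueJoint hp
  exact ⟨p.1, by rw [hcard, min_eq_left hκ], hclique⟩

/-- Type-I error of the clique-number test is at most the first-moment bound. [folklore] -/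
theorem typeIError_cliqueTest_le (κ : ℕ → ℕ) (n : ℕ) :
    typeIError (RandAlg.ofDet (cliqueTest κ)) n ≤
      (n.choose (κ n) : ℝ) * 2⁻¹ ^ (κ n * (κ n - 1) / 2) := by
  rw [typeIError, acceptProbOn_ofDet_eq]
  have hev : {G : EdgeVec n | cliqueTest κ (boolPair (unaryEncodeNat n) (encodeEdgeVec G)) = true}
      = {x | ∃ T : Finset (Fin n), T.card = κ n ∧ (graphOfEdgeVec x).IsClique (T : Set (Fin n))} :=
    Set.ext fun G => cliqueTest_boolPair κ n G
  rw [hev]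
  have hle := toOuterMeasure_exists_clique_le n (κ n)
  have hne : (n.choose (κ n) : ℝ≥0∞) * 2⁻¹ ^ (κ n * (κ n - 1) / 2) ≠ ∞ :=
    ENNReal.mul_ne_top (ENNReal.natCast_ne_top _)
      (ENNReal.pow_ne_top (ENNReal.inv_ne_top.2 two_ne_zero))
  have key := ENNReal.toReal_mono hne hle
  rw [ENNReal.toReal_mul, ENNReal.toReal_pow, ENNReal.toReal_inv, ENNReal.toReal_natCast,
    ENNReal.toReal_ofNat] at key
  exact key

/-! ## The admissible sequence `κ n = 4 ⌊log₂ n⌋ + 4` -/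

/-- The clique size of the witness: `4 ⌊log₂ n⌋ + 4`. [folklore] -/
def kappa (n : ℕ) : ℕ := 4 * Nat.log 2 n + 4

/-- The first-moment bound at `κ`: `4 · C(n, κ n) ≤ 2^{C(κ n, 2)}` for every `n`
(`n < 2^{⌊log₂ n⌋+1}`, so `n^k ≤ 2^{(⌊log₂ n⌋+1)k}`, and `(L+1)(4L+4) + 2 ≤ (2L+2)(4L+3)`).
[folklore] -/
theorem four_mul_choose_kappa_le (n : ℕ) :
    4 * n.choose (kappa n) ≤ 2 ^ (kappa n * (kappa n - 1) / 2) := by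
  set L := Nat.log 2 n with hL
  have hk : kappa n = 4 * L + 4 := rfl
  have hn : n ≤ 2 ^ (L + 1) := (Nat.lt_pow_succ_log_self one_lt_two n).le
  have hchoose : n.choose (kappa n) ≤ 2 ^ ((L + 1) * kappa n) :=
    calc n.choose (kappa n) ≤ n.descFactorial (kappa n) := Nat.choose_le_descFactorial n _
      _ ≤ n ^ kappa n := Nat.descFactorial_le_pow n _
      _ ≤ (2 ^ (L + 1)) ^ kappa n := Nat.pow_le_pow_left hn _
      _ = 2 ^ ((L + 1) * kappa n) := by rw [← pow_mul]
  have hexp : (L + 1) * kappa n + 2 ≤ kappa n * (kappa n - 1) / 2 := by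
    rw [hk, show 4 * L + 4 - 1 = 4 * L + 3 by omega,
      show (4 * L + 4) * (4 * L + 3) = 2 * ((2 * L + 2) * (4 * L + 3)) by ring,
      Nat.mul_div_cancel_left _ two_pos]
    nlinarith [Nat.zero_le L]
  calc 4 * n.choose (kappa n) ≤ 4 * 2 ^ ((L + 1) * kappa n) := Nat.mul_le_mul_left 4 hchoose
    _ = 2 ^ ((L + 1) * kappa n + 2) := by rw [pow_add]; ring
    _ ≤ 2 ^ (kappa n * (kappa n - 1) / 2) := Nat.pow_le_pow_right two_pos hexp

/-- Hence the clique-number test at `κ` has type-I error `≤ 1/4` at EVERY `n`. [folklore] -/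
theorem typeIError_cliqueTest_kappa_le (n : ℕ) :
    typeIError (RandAlg.ofDet (cliqueTest kappa)) n ≤ 1 / 4 := by
  refine (typeIError_cliqueTest_le kappa n).trans ?_
  have h : (4 : ℝ) * (n.choose (kappa n) : ℝ) ≤ (2 : ℝ) ^ (kappa n * (kappa n - 1) / 2) := by
    exact_mod_cast four_mul_choose_kappa_le n
  rw [inv_pow, ← div_eq_mul_inv, div_le_iff₀ (by positivity)]
  linarith

/-- `⌊log₂ n⌋ ≤ log n / log 2`. [folklore] -/
theorem natLog_two_le (hn : n ≠ 0) : (Nat.log 2 n : ℝ) ≤ Real.log n / Real.log 2 := by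
  rw [le_div_iff₀ (Real.log_pos one_lt_two), ← Real.log_pow]
  refine Real.log_le_log (by positivity) ?_
  exact_mod_cast Nat.pow_log_le_self 2 hn

/-- `κ n ≤ n^{1/4}` eventually (`log n = o(n^{1/4})`). [folklore] -/
theorem kappa_le_rpow_eventually :
    ∀ᶠ n : ℕ in atTop, (kappa n : ℝ) ≤ (n : ℝ) ^ (1 / 4 : ℝ) := by
  have hlo := (isLittleO_log_rpow_atTop (show (0 : ℝ) < 1 / 4 by norm_num)).comp_tendsto
    tendsto_natCast_atTop_atTop
  have hb := hlo.bound (show (0 : ℝ) < Real.log 2 / 8 by positivity)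
  filter_upwards [hb, eventually_ge_atTop 4096] with n hlog hn
  have hn0 : n ≠ 0 := by omega
  have hlog2 : 0 < Real.log 2 := Real.log_pos one_lt_two
  simp only [Function.comp_apply, Real.norm_eq_abs] at hlog
  rw [abs_of_nonneg (Real.log_natCast_nonneg n),
    abs_of_nonneg (Real.rpow_nonneg (Nat.cast_nonneg n) _)] at hlog
  -- 8 ≤ n^{1/4}
  have h8 : (8 : ℝ) ≤ (n : ℝ) ^ (1 / 4 : ℝ) := by
    have h4096 : (4096 : ℝ) ≤ n := by exact_mod_cast hn
    have : (8 : ℝ) = (4096 : ℝ) ^ (1 / 4 : ℝ) := by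
      rw [show (4096 : ℝ) = 8 ^ (4 : ℕ) by norm_num, show (1 / 4 : ℝ) = ((4 : ℕ) : ℝ)⁻¹ by norm_num,
        Real.pow_rpow_inv_natCast (by norm_num) (by norm_num)]
    rw [this]
    exact Real.rpow_le_rpow (by norm_num) h4096 (by norm_num)
  have hL := natLog_two_le hn0
  have hkappa : (kappa n : ℝ) = 4 * (Nat.log 2 n : ℝ) + 4 := by simp [kappa]
  rw [hkappa]
  have h1 : 4 * (Nat.log 2 n : ℝ) ≤ (n : ℝ) ^ (1 / 4 : ℝ) / 2 := by
    calc 4 * (Nat.log 2 n : ℝ) ≤ 4 * (Real.log n / Real.log 2) := by linarith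
      _ ≤ 4 * (Real.log 2 / 8 * (n : ℝ) ^ (1 / 4 : ℝ) / Real.log 2) := by
          gcongr
      _ = (n : ℝ) ^ (1 / 4 : ℝ) / 2 := by field_simp; ring
  linarith

/-- `κ` is an admissible clique-size sequence of the crux (`ε = 1/4`). [folklore] -/
theorem kappa_admissible :
    ∃ ε : ℝ, 0 < ε ∧ ∀ᶠ n : ℕ in atTop, (kappa n : ℝ) ≤ (n : ℝ) ^ (1 / 2 - ε) := by
  refine ⟨1 / 4, by norm_num, ?_⟩
  rw [show (1 / 2 - 1 / 4 : ℝ) = 1 / 4 by norm_num]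
  exact kappa_le_rpow_eventually

/-- `κ n ≤ n` eventually. [folklore] -/
theorem kappa_le_self_eventually : ∀ᶠ n : ℕ in atTop, kappa n ≤ n := by
  filter_upwards [kappa_le_rpow_eventually, eventually_ge_atTop 1] with n hn h1
  have h1' : (1 : ℝ) ≤ n := by exact_mod_cast h1
  have : (n : ℝ) ^ (1 / 4 : ℝ) ≤ (n : ℝ) := by
    conv_rhs => rw [← Real.rpow_one (n : ℝ)]
    exact Real.rpow_le_rpow_of_exponent_le h1' (by norm_num)
  exact_mod_cast hn.trans this

/-! ## Load-bearing: the time bound on the tests cannot be dropped -/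

/-- **ANY PROOF OF THE CRUX MUST USE THE POLYNOMIAL-TIME RESTRICTION ON THE TESTS.** The negated
statement is `PlantedcliqueIndistinguishable` VERBATIM with the hypothesis
`T.IsPolyTime id (fun b => [b])` deleted (tests = every `RandAlg (List Bool) Bool`); it is false INSIDE
the admissible window: at `κ n = 4⌊log₂ n⌋ + 4 ≤ n^{1/2 − 1/4}` the clique-number test has
type-I + type-II error `≤ 1/4` eventually, so the error sum is not eventually `≥ 1 − 1/2`. (The
planted clique is information-theoretically detectable from `k ≥ (2+δ) log₂ n` on; the crux is
exactly the claim that polynomial time cannot do it below `n^{1/2−ε}`.) [this work] -/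
theorem plantedcliqueIndistinguishable_false_without_polyTime :
    ¬ (∀ k : ℕ → ℕ, (∃ ε : ℝ, 0 < ε ∧ ∀ᶠ n : ℕ in atTop, (k n : ℝ) ≤ (n : ℝ) ^ (1 / 2 - ε)) →
        ∀ T : RandAlg (List Bool) Bool, ∀ η : ℝ, 0 < η →
          ∀ᶠ n : ℕ in atTop, 1 - η ≤ typeIError T n + typeIIError T k n) := by
  intro h
  have hev := h kappa kappa_admissible (RandAlg.ofDet (cliqueTest kappa)) (1 / 2) (by norm_num)
  have hII : ∀ᶠ n : ℕ in atTop, typeIIError (RandAlg.ofDet (cliqueTest kappa)) kappa n = 0 :=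
    kappa_le_self_eventually.mono fun n hn => typeIIError_cliqueTest_eq_zero hn
  obtain ⟨n, h1, h2⟩ := (hev.and hII).exists
  have h3 := typeIError_cliqueTest_kappa_le n
  linarith

end

end Summit.PneNP.PneNP.Theorems.PlantedcliqueIndistinguishable.Negative
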